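import Literature.AlgebraicGeometry.Resolution.FormalFibresRegular
import Literature.AlgebraicGeometry.Resolution.RegularLocalRingsFlatDescent
import Literature.AlgebraicGeometry.Resolution.SeparatingTranscendenceBasis
import Mathlib.RingTheory.Flat.FaithfullyFlat.Algebra
import Mathlib.RingTheory.RingHom.Flat
import Literature.AlgebraicGeometry.Resolution.AdicNoetherian
import Mathlib.RingTheory.Localization.BaseChange
import Mathlib.RingTheory.MvPowerSeries.NoZeroDivisors
import HarnessLib

/-!
# Geometric regularity from the purely inseparable case; Stacks 07PR reduced to its core

Topic: `Literature/AlgebraicGeometry/Resolution`. The leaf `Stacks07PR_powerSeries` of the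
decomposition of Matsumura's Thm. 32.3 (`FormalFibresRegular.lean`: the generic formal fibres of
the local rings of `k⟦X_1, …, X_n⟧`, `char k = p`, are geometrically regular — i.e., with
Matsumura's definition `IsGeometricallyRegular`, regular after every FINITE extension of the
base field) is reduced here to what the printed proof of Stacks 07PR actually establishes, its
purely inseparable case ("Let `L/K` be a finite purely inseparable field extension. We will show
by induction on `[L : K]` that `A_𝔭^∧ ⊗ L` is regular"), vendored as the named fact
`Stacks07PR_purelyInseparable`. The passage from purely inseparable to arbitrary finite
extensions — Stacks, Tag 0381, (2) ⇒ (1), in the finite form — is PROVED: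

* `isRegularRing_of_faithfullyFlat` — **Stacks 07NG**: regularity descends along faithfully
  flat ring maps (for a Noetherian source), from Matsumura Thm. 23.7 (i) in the tree
  (`IsRegularLocalRing.of_flat_ringHom`, `RegularLocalRingsFlatDescent.lean`).
* `isGeometricallyRegular_of_purelyInseparable` — for a Noetherian algebra `F` over a field
  `K`: if `k' ⊗_K F` is regular for every finite purely inseparable `k'/K` then `F` is
  geometrically regular over `K`. Proof (Stacks 0381): for `L/K` finite take `L'/L` and
  `l ⊆ L'` finite purely inseparable over `K` with `L' = lL` separable over `l`
  (`exists_purelyInseparable_isSeparablyGenerated`, `SeparatingTranscendenceBasis.lean`; here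
  algebraic, so separably generated = separable); then `L' ⊗_K F = L' ⊗_l (l ⊗_K F)` is regular
  (`IsRegularRing.tensorProduct_of_isSeparable_left`), and `L ⊗_K F → L' ⊗_K F` is faithfully
  flat.
* `HasRegularGenericFormalFibrePurelyInseparable D P` — the purely inseparable half of
  `HasGeomRegularGenericFormalFibre D P` (`FormalFibres.lean`): `L ⊗_{D_P} (D_P)^` regular for
  finite purely inseparable `L` over `κ(𝔭')`, `𝔭'` over `(0)`; with the converse
  `HasGeomRegularGenericFormalFibre.purelyInseparable` and, for Noetherian domains,
  `hasGeomRegularGenericFormalFibre_of_purelyInseparable` (via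
  `isNoetherianRing_genericFormalFibre`: `κ(𝔭') ⊗_S S^*` is a localisation of `S^*`).
* `Stacks07PR_purelyInseparable` — NAMED FACT, the purely inseparable case of Stacks 07PR with
  `m = 0`.
* `Stacks07PR_powerSeries_of_purelyInseparable : Stacks07PR_purelyInseparable →
  Stacks07PR_powerSeries` — PROVED (and the converse `Stacks07PR_powerSeries.purelyInseparable`).

## Sources

* The Stacks Project: Tag 07PR and the first lines of its proof; Tag 0381 ("Let `k` be a field.
  Let `A` be a `k`-algebra. Assume `A` is Noetherian. The following properties of `A` are
  equivalent: (1) `k' ⊗_k A` is regular for every finitely generated field extension `k'/k`,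
  and (2) `k' ⊗_k A` is regular for every finite purely inseparable extension `k'/k`."); Tag
  07NG ("Let `R → S` be a ring map. Assume that (1) `R → S` is faithfully flat, and (2) `S` is a
  regular ring. Then `R` is a regular ring."); Tag 030R (make separable). [StacksProject]
* H. Matsumura, *Commutative Ring Theory*, CUP 1986, Thm. 23.7 (i), p. 182 [PDF 199]; §32
  pp. 258–259 [PDF 276–277]. [Matsumura1987]
-/

noncomputable section

namespace Literature.AlgebraicGeometry.Resolution

universe u

open IsLocalRing TensorProduct IntermediateField

/-! ## Stacks 07NG: regularity descends along faithfully flat maps -/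

/-- **Stacks, Tag 07NG**: "Let `R → S` be a ring map. Assume that (1) `R → S` is faithfully
flat, and (2) `S` is a regular ring. Then `R` is a regular ring." Here for `R` Noetherian (in
the tag Noetherianity of `R` is deduced from that of `S`): for a prime `𝔭` of `R` choose `𝔮`
over it (faithful flatness), and descend regularity along the flat local homomorphism
`R_𝔭 → S_𝔮` (Matsumura Thm. 23.7 (i), `IsRegularLocalRing.of_flat_ringHom`).
[cite: StacksProject, Tag 07NG] -/
theorem isRegularRing_of_faithfullyFlat (R S : Type u) [CommRing R] [CommRing S] [Algebra R S]
    [Module.FaithfullyFlat R S] [IsNoetherianRing R] [IsRegularRing S] : IsRegularRing R := by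
  refine isRegularRing_iff.mpr fun p _ => ?_
  obtain ⟨⟨q, _⟩, hq⟩ := PrimeSpectrum.comap_surjective_of_faithfullyFlat (A := R) (B := S) ⟨p, ‹_›⟩
  have hpq : p = q.comap (algebraMap R S) := (congrArg PrimeSpectrum.asIdeal hq).symm
  have hflat : (algebraMap R S).Flat := RingHom.flat_algebraMap_iff.mpr inferInstance
  haveI := Localization.isLocalHom_localRingHom p q (algebraMap R S) hpq
  exact IsRegularLocalRing.of_flat_ringHom (Localization.localRingHom p q (algebraMap R S) hpq)
    (hflat.localRingHom q p hpq)

/-- **Regularity descends along a base change of fields**: for a field extension `L'/L` and a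
Noetherian `L`-algebra `S`, if `L' ⊗_L S` is regular then so is `S` (`S → S ⊗_L L'` is faithfully
flat; Stacks 07NG). [cite: StacksProject, Tag 07NG] -/
theorem isRegularRing_of_isRegularRing_baseChange_field (L L' S : Type u) [Field L] [Field L']
    [Algebra L L'] [CommRing S] [Algebra L S] [IsNoetherianRing S]
    [IsRegularRing (L' ⊗[L] S)] : IsRegularRing S := by
  haveI : IsRegularRing (S ⊗[L] L') :=
    IsRegularRing.of_ringEquiv (Algebra.TensorProduct.comm L L' S).toRingEquiv
  exact isRegularRing_of_faithfullyFlat S (S ⊗[L] L')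

/-! ## Stacks 0381 (2) ⇒ (1): geometric regularity from the purely inseparable case -/

section PurelyInseparable

variable (K F : Type u) [Field K] [CommRing F] [Algebra K F]

/-- An algebraically independent family over `l` in an algebraic extension of `l` is empty.
[folklore] -/
theorem finset_eq_empty_of_algebraicIndependent {l L' : Type u} [Field l] [Field L'] [Algebra l L']
    [Algebra.IsAlgebraic l L'] (s : Finset L') (hs : AlgebraicIndependent l ((↑) : s → L')) :
    s = ∅ := by
  by_contra h
  obtain ⟨x, hx⟩ := Finset.nonempty_of_ne_empty h
  exact hs.transcendental ⟨x, hx⟩ (Algebra.IsAlgebraic.isAlgebraic (x : L'))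

/-- `L'` separable over the intermediate field `⊥ = l` is separable over `l`. [folklore] -/
theorem isSeparable_of_isSeparable_bot {l L' : Type u} [Field l] [Field L'] [Algebra l L']
    (h : Algebra.IsSeparable (⊥ : IntermediateField l L') L') : Algebra.IsSeparable l L' := by
  refine Algebra.IsSeparable.of_equiv_equiv (A₁ := (⊥ : IntermediateField l L')) (B₁ := L')
    (botEquiv l L').toRingEquiv (RingEquiv.refl L') ?_
  ext y
  obtain ⟨x, rfl⟩ : ∃ x : l, algebraMap l (⊥ : IntermediateField l L') x = y :=
    ⟨botEquiv l L' y, by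
      apply (botEquiv l L').injective
      rw [botEquiv_def]⟩
  change algebraMap l L' (botEquiv l L' (algebraMap l _ x)) = (algebraMap (⊥ : IntermediateField l L') L') (algebraMap l _ x)
  rw [botEquiv_def, ← IsScalarTower.algebraMap_apply]

/-- **Geometric regularity from the purely inseparable case** (Stacks, Tag 0381, (2) ⇒ (1), in
the finite form of Matsumura's definition of geometric regularity): let `F` be a Noetherian
algebra over a field `K` such that `k' ⊗_K F` is regular for every finite purely inseparable
extension `k'/K`; then `L ⊗_K F` is regular for every finite extension `L/K`. Proof: by
`exists_purelyInseparable_isSeparablyGenerated` there are finite purely inseparable `L'/L` and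
`l/K`, `l ⊆ L'`, with `L'/l` separable (finite); `L' ⊗_K F = L' ⊗_l (l ⊗_K F)` is regular
(hypothesis for `l`, then a finite separable base change), and regularity descends along the
faithfully flat map `L ⊗_K F → L' ⊗_K F = (L ⊗_K F) ⊗_L L'` (Stacks 07NG).
[cite: StacksProject, Tag 0381] -/
theorem isGeometricallyRegular_of_purelyInseparable [IsNoetherianRing F]
    (H : ∀ (k' : Type u) [Field k'] [Algebra K k'], Module.Finite K k' →
      IsPurelyInseparable K k' → IsRegularRing (k' ⊗[K] F)) :
    IsGeometricallyRegular K F := by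
  intro L _ _ hL
  haveI := hL
  -- make separable: `L ⊆ L'`, `K ⊆ l ⊆ L'`
  obtain ⟨L', _, _, _, _, hfinL', _, l, hfinl, hpil, -, ⟨s, hind, hsep⟩, -⟩ :=
    exists_purelyInseparable_isSeparablyGenerated K L (IntermediateField.fg_top K L)
  haveI := hfinL'
  haveI := hfinl
  haveI : Module.Finite K L' := Module.Finite.trans L L'
  haveI : Module.Finite l L' := Module.Finite.of_restrictScalars_finite K l L'
  haveI : Algebra.IsAlgebraic l L' := Algebra.IsAlgebraic.of_finite l L'
  have hs : s = ∅ := finset_eq_empty_of_algebraicIndependent s hind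
  subst hs
  rw [Finset.coe_empty, adjoin_empty] at hsep
  haveI : Algebra.IsSeparable l L' := isSeparable_of_isSeparable_bot hsep
  -- `L' ⊗_K F = L' ⊗_l (l ⊗_K F)` is regular
  haveI : IsRegularRing (l ⊗[K] F) := H l inferInstance hpil
  have h1 := IsRegularRing.tensorProduct_of_isSeparable_left (l : Type u) (l ⊗[K] F) L'
  haveI : IsRegularRing (L' ⊗[K] F) :=
    @IsRegularRing.of_ringEquiv _ _ _ _
      (Algebra.TensorProduct.cancelBaseChange K l L' L' F).toRingEquiv h1
  -- `L ⊗_K F → L' ⊗_L (L ⊗_K F) ≅ L' ⊗_K F` is faithfully flat; descend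
  have h2 := @IsRegularRing.of_ringEquiv _ _ _ _
    (Algebra.TensorProduct.cancelBaseChange K L L' L' F).symm.toRingEquiv ‹IsRegularRing (L' ⊗[K] F)›
  haveI : IsNoetherianRing (F ⊗[K] L) := Algebra.FiniteType.isNoetherianRing F _
  haveI : IsNoetherianRing (L ⊗[K] F) :=
    isNoetherianRing_of_ringEquiv (F ⊗[K] L) (Algebra.TensorProduct.comm K F L).toRingEquiv
  exact @isRegularRing_of_isRegularRing_baseChange_field L L' (L ⊗[K] F) _ _ _ _ _ _ h2

end PurelyInseparable

/-! ## Stacks 07PR reduced to its purely inseparable case -/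

/-- **The generic formal fibre of `D_P` is regular after finite purely inseparable extensions
of the base field**: for every prime `𝔭'` of `S = D_P` over `(0) ⊆ D` (for a domain: `𝔭' = (0)`,
`κ(𝔭') = K = Frac D`) and every finite purely inseparable extension `L` of `κ(𝔭')` (given any
`S`-algebra structure compatible with that of `κ(𝔭')`), `L ⊗_S S^*` (`= L ⊗_{κ(𝔭')}
(κ(𝔭') ⊗_S S^*)`) is a regular ring. The purely inseparable half of
`HasGeomRegularGenericFormalFibre` (`FormalFibres.lean`); like it, meaningful for domains only.
[cite: StacksProject, Tag 07PR (proof)] -/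
def HasRegularGenericFormalFibrePurelyInseparable (D : Type u) [CommRing D] (P : Ideal D)
    [P.IsPrime] : Prop :=
  ∀ (p' : Ideal (Localization.AtPrime P)) [p'.IsPrime],
    p'.comap (algebraMap D (Localization.AtPrime P)) = ⊥ →
    ∀ (L : Type u) [Field L] [Algebra p'.ResidueField L] [Algebra (Localization.AtPrime P) L]
      [IsScalarTower (Localization.AtPrime P) p'.ResidueField L],
      Module.Finite p'.ResidueField L → IsPurelyInseparable p'.ResidueField L →
        IsRegularRing (L ⊗[Localization.AtPrime P]
          AdicCompletion (maximalIdeal (Localization.AtPrime P)) (Localization.AtPrime P))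

/-- Sanity / equi-strength: `HasGeomRegularGenericFormalFibre` contains its purely inseparable
half (`L ⊗_κ (κ ⊗_S S^*) ≅ L ⊗_S S^*`). [folklore] -/
theorem HasGeomRegularGenericFormalFibre.purelyInseparable {D : Type u} [CommRing D]
    {P : Ideal D} [P.IsPrime] (h : HasGeomRegularGenericFormalFibre D P) :
    HasRegularGenericFormalFibrePurelyInseparable D P := by
  intro p' _ hp' L _ _ _ _ hL _
  haveI := h p' hp' L hL
  exact IsRegularRing.of_ringEquiv
    (Algebra.TensorProduct.cancelBaseChange (Localization.AtPrime P) p'.ResidueField L L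
      (AdicCompletion (maximalIdeal (Localization.AtPrime P)) (Localization.AtPrime P))).toRingEquiv

/-- **The generic formal fibre ring of a Noetherian local domain is Noetherian**: for a
Noetherian domain `D` and a prime `P`, with `S = D_P` and the prime `𝔭' = (0)` of `S` (the primes
of `S` over `(0) ⊆ D`), `κ(𝔭') ⊗_S S^* = K ⊗_S S^*` is the localisation of the Noetherian ring
`S^*` (Stacks 0316) at `S ∖ 0`. [folklore] -/
theorem isNoetherianRing_genericFormalFibre {D : Type u} [CommRing D] [IsDomain D]
    [IsNoetherianRing D] (P : Ideal D) [P.IsPrime] (p' : Ideal (Localization.AtPrime P))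
    [p'.IsPrime] (hp' : p'.comap (algebraMap D (Localization.AtPrime P)) = ⊥) :
    IsNoetherianRing (p'.ResidueField ⊗[Localization.AtPrime P]
      AdicCompletion (maximalIdeal (Localization.AtPrime P)) (Localization.AtPrime P)) := by
  have hbot : p' = ⊥ := by
    rw [← IsLocalization.map_under P.primeCompl (Localization.AtPrime P) p', Ideal.under_def,
      hp', Ideal.map_bot]
  subst hbot
  haveI : IsNoetherianRing
      (AdicCompletion (maximalIdeal (Localization.AtPrime P)) (Localization.AtPrime P)) :=
    isNoetherianRing_adicCompletion_maximalIdeal _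
  letI : Algebra (AdicCompletion (maximalIdeal (Localization.AtPrime P)) (Localization.AtPrime P))
      ((⊥ : Ideal (Localization.AtPrime P)).ResidueField ⊗[Localization.AtPrime P]
        AdicCompletion (maximalIdeal (Localization.AtPrime P)) (Localization.AtPrime P)) :=
    Algebra.TensorProduct.rightAlgebra
  exact IsLocalization.isNoetherianRing
    (Algebra.algebraMapSubmonoid
      (AdicCompletion (maximalIdeal (Localization.AtPrime P)) (Localization.AtPrime P))
      (nonZeroDivisors (Localization.AtPrime P)))
    ((⊥ : Ideal (Localization.AtPrime P)).ResidueField ⊗[Localization.AtPrime P]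
      AdicCompletion (maximalIdeal (Localization.AtPrime P)) (Localization.AtPrime P))
    inferInstance

/-- **From the purely inseparable half to geometric regularity of the generic formal fibre**,
for the local rings of a Noetherian domain (Stacks 0381 applied to the Noetherian fibre ring
`κ(𝔭') ⊗_S S^*`). [cite: StacksProject, Tag 0381] -/
theorem hasGeomRegularGenericFormalFibre_of_purelyInseparable {D : Type u} [CommRing D]
    [IsDomain D] [IsNoetherianRing D] (P : Ideal D) [P.IsPrime]
    (h : HasRegularGenericFormalFibrePurelyInseparable D P) :
    HasGeomRegularGenericFormalFibre D P := by
  intro p' _ hp'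
  haveI := isNoetherianRing_genericFormalFibre P p' hp'
  refine isGeometricallyRegular_of_purelyInseparable p'.ResidueField _ fun L _ _ hL hpi => ?_
  letI : Algebra (Localization.AtPrime P) L :=
    ((algebraMap p'.ResidueField L).comp
      (algebraMap (Localization.AtPrime P) p'.ResidueField)).toAlgebra
  haveI : IsScalarTower (Localization.AtPrime P) p'.ResidueField L :=
    IsScalarTower.of_algebraMap_eq fun _ => rfl
  have hreg := h p' hp' L hL hpi
  exact @IsRegularRing.of_ringEquiv _ _ _ _
    (Algebra.TensorProduct.cancelBaseChange (Localization.AtPrime P) p'.ResidueField L L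
      (AdicCompletion (maximalIdeal (Localization.AtPrime P)) (Localization.AtPrime P))).symm.toRingEquiv
    hreg

/-- NAMED FACT — **Stacks 07PR (`m = 0`), purely inseparable case.** Stacks, Tag 07PR: "Let `k`
be a field of characteristic `p`. Let `A = k⟦x_1, …, x_n⟧[y_1, …, y_m]` and denote `K` the
fraction field of `A`. Let `𝔭 ⊆ A` be a prime. Then `A_𝔭^∧ ⊗_A K` is geometrically regular over
`K`", whose proof begins "Let `L/K` be a finite purely inseparable field extension. We will show
by induction on `[L : K]` that `A_𝔭^∧ ⊗ L` is regular" and establishes exactly that (the passage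
to all finitely generated `L/K` being Stacks 0381). Vendored: that purely inseparable statement,
for `m = 0` (`HasRegularGenericFormalFibrePurelyInseparable`: for the prime `𝔭'` of `A_𝔭` over
`(0)`, `K = κ(𝔭')`, and every finite purely inseparable `L/K`, `L ⊗_{A_𝔭} (A_𝔭)^∧` is regular).
The printed induction uses: derivations of `k⟦x⟧` non-vanishing on non-`p`-th powers (Tag 07PH,
via 07PD), their extension to localisations and completions (07PE), `R[z]/(zᵖ - f)` regular
when `D f` is a unit (07PG, 07PF), and the completion of a finite extension (07N9). Users take
`(h : Stacks07PR_purelyInseparable)`. [cite: StacksProject, Tag 07PR] -/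
def Stacks07PR_purelyInseparable : Prop :=
  ∀ (k : Type u) [Field k] (p : ℕ) [Fact p.Prime] [CharP k p] (n : ℕ)
    (q : Ideal (MvPowerSeries (Fin n) k)) [q.IsPrime],
      HasRegularGenericFormalFibrePurelyInseparable (MvPowerSeries (Fin n) k) q

/-- Sanity / equi-strength: `Stacks07PR_powerSeries` contains its purely inseparable case.
[folklore] -/
theorem Stacks07PR_powerSeries.purelyInseparable (h : Stacks07PR_powerSeries.{u}) :
    Stacks07PR_purelyInseparable.{u} :=
  fun k _ p _ _ n q _ => (h k p n q).purelyInseparable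

/-- **Stacks 07PR (`m = 0`) from its purely inseparable case**, by Stacks 0381
(`hasGeomRegularGenericFormalFibre_of_purelyInseparable`; `k⟦X_1, …, X_n⟧` is a Noetherian
domain). [cite: StacksProject, Tag 07PR] -/
theorem Stacks07PR_powerSeries_of_purelyInseparable (h : Stacks07PR_purelyInseparable.{u}) :
    Stacks07PR_powerSeries.{u} := by
  intro k _ p _ _ n q _
  haveI : IsNoetherianRing (MvPowerSeries (Fin n) k) := isNoetherianRing_mvPowerSeries (R := k) (Fin n)
  haveI : IsDomain (MvPowerSeries (Fin n) k) := NoZeroDivisors.to_isDomain _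
  exact hasGeomRegularGenericFormalFibre_of_purelyInseparable q (h k p n q)

end Literature.AlgebraicGeometry.Resolution

end
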